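import Mathlib
import Literature.Probability.MarkovChains.TotalVariation
import Summits.Ventures.LatticeQCDFlow.Scaling.ImportanceWeights

/-!
# LatticeQCDFlow / Scaling — the block defect from ONE connected correlator (T2-N)

HONEST FRAMING: exact (Metropolis-corrected) sampling algorithms for lattice gauge theory;
figures of merit are autocorrelation/cost numbers at stated couplings and volumes; no
continuum-physics claim.

Venture `LatticeQCDFlow` (cell pub-lqcd), topic `Scaling`, item T2-N of HOME/THEORY-2.md §4
(v1.3), landed by FANOUT row 31 from `HOME/THEORY-2-Sketch.lean` (theory seat, decls verbatim).
The only non-theorem input of the volume law (`Scaling/BlockDefect.lean`) is the per-block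
defect `δ(β, R) > 0` of hypothesis (U): the target's block law `r` is at total variation `≥ δ`
from EVERY law `a ⊗ b` that makes the two halves of the block independent.  The lemma below
reduces (U) to (U′): the non-vanishing, uniformly in `L`, of ONE normalised connected correlator
across the block's internal cut (e.g. two plaquettes at separation `≈ 2R + 1`).

* `abs_sum_mul_sub_le_tvDist` — `|E_r h − E_s h| ≤ 2 M · TV(r, s)` for `|h| ≤ M`;
* `abs_cov_le_tvDist_prodLaw` / `DefectFromCorrelation` / `defectFromCorrelation` — for a joint
  law `r` on `X × Y`, ANY product law `a ⊗ b` and 1-bounded `f`, `g`: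
  `|E_r[f g] − E_r f · E_r g| ≤ 6 · TV(r, a ⊗ b)`, hence `δ ≥ |⟨f g⟩_c| / 6`.
-/

namespace Summit.Ventures.LatticeQCDFlow.Theory2

open Finset Literature.Probability.MarkovChains

section CovDefect

variable {X Y : Type*} [Fintype X] [Fintype Y]

omit [Fintype Y] in
/-- Bounded test functions see two weight functions only up to `2·sup|h|·TV`. [folklore] -/
theorem abs_sum_mul_sub_le_tvDist {r s : X → ℝ} {h : X → ℝ} {M : ℝ} (hh : ∀ x, |h x| ≤ M) :
    |∑ x, r x * h x - ∑ x, s x * h x| ≤ 2 * M * tvDist r s := by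
  rw [tvDist, ← Finset.sum_sub_distrib]
  calc |∑ x, (r x * h x - s x * h x)|
      ≤ ∑ x, |r x * h x - s x * h x| := Finset.abs_sum_le_sum_abs _ _
    _ = ∑ x, |r x - s x| * |h x| := by
          refine Finset.sum_congr rfl fun x _ => ?_
          rw [← sub_mul, abs_mul]
    _ ≤ ∑ x, |r x - s x| * M :=
          Finset.sum_le_sum fun x _ => mul_le_mul_of_nonneg_left (hh x) (abs_nonneg _)
    _ = 2 * M * (1 / 2 * ∑ x, |r x - s x|) := by rw [← Finset.sum_mul]; ring

/-- **T2-N (block defect from a connected correlation; proved).**  For a joint law `r` on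
`X × Y` and ANY product law `a ⊗ b`, every pair of `1`-bounded observables `f` (on `X`) and `g`
(on `Y`) has connected correlation `|E_r[fg] − E_r[f]·E_r[g]| ≤ 6·TV(r, a ⊗ b)`.  Consequently
the per-block defect `δ` of hypothesis (U) — the distance of the target's law on a block from
every law under which the two halves of the block are independent — is at least ONE SIXTH of
any normalised connected cross-boundary correlator (e.g. of two plaquettes on either side of
the cut): (U) follows from `inf_L |⟨P₁P₂⟩_c| > 0`, a strong-coupling-expansion number at small
`β` and a routinely measured one elsewhere. [folklore] -/
theorem abs_cov_le_tvDist_prodLaw {r : X × Y → ℝ} (hr : ∀ z, 0 ≤ r z) (hr1 : ∑ z, r z = 1)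
    {a : X → ℝ} {b : Y → ℝ} (ha1 : ∑ x, a x = 1) (hb : ∀ y, 0 ≤ b y) (hb1 : ∑ y, b y = 1)
    {f : X → ℝ} {g : Y → ℝ} (hf : ∀ x, |f x| ≤ 1) (hg : ∀ y, |g y| ≤ 1) :
    |∑ z, r z * (f z.1 * g z.2) - (∑ z, r z * f z.1) * (∑ z, r z * g z.2)|
      ≤ 6 * tvDist r (prodLaw a b) := by
  set T := tvDist r (prodLaw a b) with hT
  have hT0 : 0 ≤ T := tvDist_nonneg _ _
  set A := ∑ x, a x * f x with hA
  set B := ∑ y, b y * g y with hB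
  set F := ∑ z, r z * f z.1 with hF
  set G := ∑ z, r z * g z.2 with hG
  -- product-law expectations factorise
  have hfg : ∑ z, prodLaw a b z * (f z.1 * g z.2) = A * B := by
    simp only [prodLaw, Fintype.sum_prod_type, hA, hB, Finset.sum_mul_sum]
    refine Finset.sum_congr rfl fun x _ => Finset.sum_congr rfl fun y _ => ?_; ring
  have hf1 : ∑ z, prodLaw a b z * f z.1 = A := by
    simp only [prodLaw, Fintype.sum_prod_type, hA]
    refine Finset.sum_congr rfl fun x _ => ?_
    rw [show ∑ y, a x * b y * f x = a x * f x * ∑ y, b y by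
      rw [Finset.mul_sum]; exact Finset.sum_congr rfl fun y _ => by ring, hb1, mul_one]
  have hg1 : ∑ z, prodLaw a b z * g z.2 = B := by
    simp only [prodLaw, Fintype.sum_prod_type, hB]
    rw [show ∑ x, ∑ y, a x * b y * g y = ∑ x, a x * ∑ y, b y * g y by
      refine Finset.sum_congr rfl fun x _ => ?_
      rw [Finset.mul_sum]; exact Finset.sum_congr rfl fun y _ => by ring,
      ← Finset.sum_mul, ha1, one_mul]
  -- the three TV comparisons
  have hfgb : ∀ z : X × Y, |f z.1 * g z.2| ≤ 1 := fun z => by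
    rw [abs_mul]; exact mul_le_one₀ (hf _) (abs_nonneg _) (hg _)
  have h1 : |∑ z, r z * (f z.1 * g z.2) - A * B| ≤ 2 * T := by
    have := abs_sum_mul_sub_le_tvDist (r := r) (s := prodLaw a b) hfgb
    rw [hfg] at this; linarith
  have h2 : |F - A| ≤ 2 * T := by
    have := abs_sum_mul_sub_le_tvDist (r := r) (s := prodLaw a b) (h := fun z => f z.1)
      (fun z => hf z.1)
    rw [hf1] at this; simp only [hF]; linarith
  have h3 : |G - B| ≤ 2 * T := by
    have := abs_sum_mul_sub_le_tvDist (r := r) (s := prodLaw a b) (h := fun z => g z.2)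
      (fun z => hg z.2)
    rw [hg1] at this; simp only [hG]; linarith
  -- a priori bounds |B| ≤ 1, |F| ≤ 1
  have hBle : |B| ≤ 1 := by
    calc |B| ≤ ∑ y, |b y * g y| := Finset.abs_sum_le_sum_abs _ _
      _ ≤ ∑ y, b y := Finset.sum_le_sum fun y _ => by
            rw [abs_mul, abs_of_nonneg (hb y)]
            exact mul_le_of_le_one_right (hb y) (hg y)
      _ = 1 := hb1
  have hFle : |F| ≤ 1 := by
    calc |F| ≤ ∑ z, |r z * f z.1| := Finset.abs_sum_le_sum_abs _ _
      _ ≤ ∑ z, r z := Finset.sum_le_sum fun z _ => by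
            rw [abs_mul, abs_of_nonneg (hr z)]
            exact mul_le_of_le_one_right (hr z) (hf z.1)
      _ = 1 := hr1
  -- assemble
  have hAB : |A * B - F * G| ≤ 4 * T := by
    calc |A * B - F * G| ≤ |A * B - F * B| + |F * B - F * G| := abs_sub_le _ _ _
      _ = |A - F| * |B| + |F| * |B - G| := by
            rw [← sub_mul, ← mul_sub, abs_mul, abs_mul]
      _ ≤ 2 * T * 1 + 1 * (2 * T) := by
            gcongr
            · rw [abs_sub_comm]; exact h2
            · rw [abs_sub_comm]; exact h3
      _ = 4 * T := by ring
  calc |∑ z, r z * (f z.1 * g z.2) - F * G|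
      ≤ |∑ z, r z * (f z.1 * g z.2) - A * B| + |A * B - F * G| := abs_sub_le _ _ _
    _ ≤ 2 * T + 4 * T := add_le_add h1 hAB
    _ = 6 * T := by ring

end CovDefect

/-- **T2-N packaged (typed verbatim; proved).**  `δ ≥ |connected correlator| / 6`. [folklore] -/
def DefectFromCorrelation : Prop :=
  ∀ (X Y : Type) [Fintype X] [Fintype Y] (r : X × Y → ℝ) (a : X → ℝ) (b : Y → ℝ)
    (f : X → ℝ) (g : Y → ℝ),
    (∀ z, 0 ≤ r z) → ∑ z, r z = 1 → ∑ x, a x = 1 → (∀ y, 0 ≤ b y) → ∑ y, b y = 1 →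
    (∀ x, |f x| ≤ 1) → (∀ y, |g y| ≤ 1) →
      |∑ z, r z * (f z.1 * g z.2) - (∑ z, r z * f z.1) * (∑ z, r z * g z.2)|
        ≤ 6 * tvDist r (prodLaw a b)

/-- T2-N holds (`abs_cov_le_tvDist_prodLaw`). [folklore] -/
theorem defectFromCorrelation : DefectFromCorrelation :=
  fun _ _ _ _ _ _ _ _ _ hr hr1 ha1 hb hb1 hf hg => abs_cov_le_tvDist_prodLaw hr hr1 ha1 hb hb1 hf hg

end Summit.Ventures.LatticeQCDFlow.Theory2
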